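/- Copyright: the b2b-balaban cell (near-miss cell 7), T⁴-continuum fan-out; row NE7b ROUND-2 swarm, seat
t4-ne7b-formalise-leaf-06 (gen 4) (road W-RP-VAR, sub-piece «W3e BLOCK GEOMETRY OF THE BASE RP-PACKAGE»; INTENT journal
l.14455).  Released under the licence of the surrounding project. -/
import Literature.Barriers.CriticalPhenomena.PositionSpaceRGNonGibbsianChessboard
import Summits.QuantumFields.BalabanUV.T4Continuum.Support.HistoryRPBase
import Summits.QuantumFields.YangMills.Theorems.ComplexCouplingChannelContinuumLegGivenGapArrayFunctionalReflection

/-!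
# Road W-RP-VAR, sub-piece W3e: BLOCK GEOMETRY OF THE BASE RP-PACKAGE — cells, half-spaces, block reflections

Summits-side support leaf of the T⁴-continuum cell (rung (B)+1 on a FINITE torus only; NOT infinite volume, NOT the
mass gap, NOT the Clay statement; NOT a proof of the spine estimate NE7b).  Row NE7b, road **W-RP-VAR** (owner's ruling
R-OWNER-23-2), a small supplier beside row W3c (`HistoryRPBase`, leaf-04 g5) and row W4 file 3
(`HistoryChessboardEventsCutoff`, this lineage).  [folklore] finite torus geometry (`ZMod` arithmetic) + σ-algebra
bookkeeping (Mathlib); it CONSUMES BY NAME the letters of W3c's `rpPackage_wilson_theta` (reflection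
`Θ_{π,v} U = τ_v (π_* (Θ₀ (π_*⁻¹ (τ_{−v} U))))`, positive σ-algebra `(piFinset posEdges).comap (π_*⁻¹ ∘ τ_{−v})`), the
block-torus letters of W2∕W4∕W5 (`BlockIdx d N`, `cellReflect i k`, `halfPlus N i k` of the tree's chessboard estimate) and
the Yang–Mills helper module's wall reflection `ContinuumLegGivenGap.configReflect μ A` ∕ `siteReflect μ A` (REUSED, not
re-declared).  Nothing is quoted from Bałaban's papers, nothing printed is asserted, no citation tag of the series, no
`Prop`-valued fact minted (trigger c1); three small DATA definitions (`cellOf`, `cellLinks`, `cutShift`).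

WHY ∕ WHAT.  W4∕W5∕W4b′ speak of the CELL torus `BlockIdx d N`; the chessboard estimate reflects cells by
`cellReflect i k : c_i ↦ 2k − 1 − c_i` with positive half `halfPlus N i k = {(c_i − k).val < N∕2}`; W4b′'s `CutoffReading`
DISPLAYS per block hyperplane `(i, k)` the RP-package AND the geometric clauses `loc`, `sym`.  W3c produces the RP-package
of the level-0 (Wilson) state at FINE hyperplanes `(π, v)` of `GaugeConfig d L G`.  Junction, with `N` cells of `b` fine
sites per direction (fine side `N·b`): the block hyperplane `(i, k)` IS W3c's `(π, v) := (swap 0 i, cutShift b i k)`,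
`cutShift b i k = (k·b − 1)·e_i`.  §2 **`theta_swap_eq_configReflect`**: `Θ_{swap 0 i, v}` is the wall reflection
`configReflect i (2v_i + 1)` (sites `x_i ↦ 2v_i + 1 − x_i`; links along `i` reversed and inverted) — at the block cut
`x_i ↦ 2kb − 1 − x_i`; §3 **`pos_of_cellOf_mem_halfPlus`**: every site of a cell of `halfPlus N i k` lies in the
transported Osterwalder–Seiler slab (`x_i − kb + 1 ∈ [1, Nb∕2]`), whence the `loc` SUPPLIER **`piFinset_cellLinks_le`**
(events measurable in the links inside a positive-half cell are measurable for W3c's positive σ-algebra); §4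
**`cellOf_siteReflect`**: the block reflection carries cell `c` onto `cellReflect i k c`, and the `sym` geometry
**`dependsOn_comp_theta`** (an observable of the links inside `c`, composed with `Θ`, is an observable of the links inside
`cellReflect i k c`).  That a reflected large-field TEMPLATE is the template of the reflected cell is the instantiating
seat's (R-sym) sentence and stays displayed.  No parity of `N` is used here.  §5 decided sanity instances.

HONEST SCOPE: geometry∕bookkeeping for the CENTRED-AVERAGING VARIANT's producer; no field of `CutoffReading` is discharged
for Bałaban's state (none is instantiated); no exit ∕ socket ∕ `HistoryConstants` file touched (c3); no constant specialised
(c2∕c6).  NE7b NOT proved; spine 0∕9.  HONEST DEPENDENCY (cell): continuum YM on T⁴ ⇐ BetaPertH ∧ nine spine estimates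
(0/9 proved); BetaPertH ⇐ (D1) ∧ (D4) ∧ CAP+tail; G-an2-4 gates asym, D1 and NE2/3/4.  This file changes none of it.
-/

open MeasureTheory Literature.Barriers.CriticalPhenomena.NonGibbs
open Literature.MathematicalPhysics.QuantumFieldTheory
open Summit.QuantumFields.YangMills.Theorems.ContinuumLegGivenGap

namespace Summit.QuantumFields.BalabanUV.T4Continuum.HistoryRPBlocks

noncomputable section

/-! ## §1 Cells of the fine torus, their links, the cut of a block hyperplane -/
section Cells
variable {d N : ℕ}

/-- **THE CELL OF A FINE SITE**: `N` cells of `b` consecutive sites per direction on the fine torus of side `N·b`; the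
cell index of `x` in direction `j` is `⌊x_j.val ∕ b⌋ (mod N)`. [folklore] -/
def cellOf (b : ℕ) (x : Site d (N * b)) : BlockIdx d N := fun j => (((x j).val / b : ℕ) : ZMod N)

/-- **THE LINKS INSIDE A CELL**: both endpoints in the cell. [folklore] -/
def cellLinks [NeZero N] (b : ℕ) [NeZero b] (c : BlockIdx d N) : Finset (Edge d (N * b)) :=
  Finset.univ.filter fun e => cellOf b e.1 = c ∧ cellOf b (e.1.shift e.2) = c

/-- **THE CUT OF THE BLOCK HYPERPLANE `(i, k)`** as W3c's translation letter: `v = (k·b − 1)·e_i` (W3c reflects axis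
`π 0 = i` through the cut between the fine slices `v_i ∣ v_i + 1 = kb − 1 ∣ kb`, i.e. between the cells `k − 1 ∣ k`).
[folklore] -/
def cutShift (b : ℕ) (i : Fin d) (k : ZMod N) : Site d (N * b) :=
  Pi.single i ((((k.val * b : ℕ) : ZMod (N * b))) - 1)

variable [NeZero N] {b : ℕ}

/-- membership in `cellLinks`. [folklore] -/
@[simp] theorem mem_cellLinks [NeZero b] {c : BlockIdx d N} {e : Edge d (N * b)} :
    e ∈ cellLinks b c ↔ cellOf b e.1 = c ∧ cellOf b (e.1.shift e.2) = c := by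
  simp [cellLinks]

/-- the cut translation along the reflected axis. [folklore] -/
@[simp] theorem cutShift_apply_same (i : Fin d) (k : ZMod N) :
    cutShift b i k i = (((k.val * b : ℕ) : ZMod (N * b))) - 1 := by
  simp [cutShift]
end Cells

/-! ## §1b Two `ZMod` tools: values of integer casts pinned by a congruence -/
section ZModTools
variable {M : ℕ}

/-- An integer congruent mod `M` to a natural number `r < M` casts to an element of `ZMod M` of value `r`. [folklore] -/
theorem val_intCast_of_modEq {t : ℤ} {r : ℕ} (hr : r < M) (h : t ≡ r [ZMOD M]) : ((t : ZMod M)).val = r := by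
  have h1 : ((t : ZMod M)) = ((r : ℤ) : ZMod M) := (ZMod.intCast_eq_intCast_iff t r M).2 h
  rw [h1, Int.cast_natCast, ZMod.val_natCast, Nat.mod_eq_of_lt hr]

variable {N b : ℕ} [NeZero N]

/-- **THE CELL ARITHMETIC LEMMA**: on the fine torus of side `N·b`, the integer `a·b + r₀` with `0 ≤ r₀ < b` casts to an
element of value `(a mod N)·b + r₀` — so its cell is `a mod N` and its offset `r₀`. [folklore] -/
theorem val_intCast_mul_add (a : ℤ) {r₀ : ℕ} (hr : r₀ < b) :
    (((a * b + r₀ : ℤ)) : ZMod (N * b)).val = (a % N).toNat * b + r₀ := by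
  have hN : (0 : ℤ) < N := by exact_mod_cast Nat.pos_of_ne_zero (NeZero.ne N)
  have hQ : ((a % N).toNat : ℤ) = a % N := Int.toNat_of_nonneg (Int.emod_nonneg _ hN.ne')
  have hQlt : (a % N).toNat < N := by
    have : ((a % N).toNat : ℤ) < N := by rw [hQ]; exact Int.emod_lt_of_pos _ hN
    exact_mod_cast this
  apply val_intCast_of_modEq
  · calc (a % N).toNat * b + r₀ < (a % N).toNat * b + b := by omega
      _ = ((a % N).toNat + 1) * b := by ring
      _ ≤ N * b := Nat.mul_le_mul_right _ (by omega)
  · obtain ⟨t, ht⟩ := Int.modEq_iff_dvd.1 (Int.mod_modEq a N)   -- `a - a % N = N * t`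
    refine Int.modEq_iff_dvd.2 ⟨-t, ?_⟩
    push_cast
    rw [hQ]
    linear_combination (-(b : ℤ)) * ht
end ZModTools

/-! ## §2 W3c's transported reflection at `π = swap 0 i` IS the wall reflection of axis `i` through `v_i ∣ v_i + 1` -/
section Theta
variable {d L : ℕ} [NeZero d] {G : Type*} [Group G] [MeasurableSpace G]

/-- **`Θ_{swap 0 i, v} = configReflect i (2·v_i + 1)`** for EVERY translation `v`: W3c's reflection letter at the axis
transposition `0 ↔ i` is the Yang–Mills helper's wall reflection (sites `x_i ↦ 2v_i + 1 − x_i`, the cut `v_i ∣ v_i + 1`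
of axis `i`; links across the axis carried along, links along it reversed and inverted).  Pure unfolding. [folklore] -/
theorem theta_swap_eq_configReflect (i : Fin d) (v : Site d L) (U : GaugeConfig d L G) :
    torusConfigShift v (configPerm (Equiv.swap 0 i)
        (GaugeConfig.timeReflect (configPerm (Equiv.swap 0 i).symm (torusConfigShift (-v) U)))) =
      configReflect i (2 * v i + 1) U := by
  funext e
  obtain ⟨x, j⟩ := e
  have hπ0 : (Equiv.swap (0 : Fin d) i) i = 0 := Equiv.swap_apply_right _ _
  have hπne : ∀ {m : Fin d}, m ≠ i → (Equiv.swap (0 : Fin d) i) m ≠ 0 := fun {m} hm h =>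
    hm (by rwa [Equiv.swap_apply_eq_iff, Equiv.swap_apply_left] at h)
  simp only [Equiv.symm_swap, GaugeConfig.timeReflect, configPerm_apply, torusConfigShift_apply, sub_neg_eq_add]
  by_cases hj : j = i
  · subst hj
    rw [if_pos hπ0, configReflect_apply_same, Equiv.swap_apply_left]
    congr 2
    refine Prod.ext ?_ rfl
    funext m
    by_cases hm : m = j
    · subst hm
      simp only [Pi.add_apply, Pi.sub_apply, sitePerm_apply, Equiv.symm_swap, Equiv.swap_apply_right,
        Equiv.swap_apply_left, WilsonRP.timeReflect_apply_zero, Site.shift, Pi.single_eq_same, siteReflect_apply_same]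
      ring
    · simp only [Pi.add_apply, Pi.sub_apply, sitePerm_apply, Equiv.symm_swap, Equiv.swap_apply_self,
        WilsonRP.timeReflect_apply_of_ne _ (hπne hm), Site.shift, Pi.single_eq_of_ne (hπne hm),
        Pi.single_eq_of_ne hm, siteReflect_apply_of_ne _ _ _ hm]
      ring
  · rw [if_neg (hπne hj), configReflect_apply_of_ne _ _ _ _ hj, Equiv.swap_apply_self]
    congr 1
    refine Prod.ext ?_ rfl
    funext m
    by_cases hm : m = i
    · subst hm
      simp only [Pi.add_apply, Pi.sub_apply, sitePerm_apply, Equiv.symm_swap, Equiv.swap_apply_right,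
        Equiv.swap_apply_left, WilsonRP.timeReflect_apply_zero, siteReflect_apply_same]
      ring
    · simp only [Pi.add_apply, Pi.sub_apply, sitePerm_apply, Equiv.symm_swap, Equiv.swap_apply_self,
        WilsonRP.timeReflect_apply_of_ne _ (hπne hm), siteReflect_apply_of_ne _ _ _ hm]
      ring
end Theta

/-! ## §3 The positive half of the block hyperplane `(i, k)` contains the cells of `halfPlus N i k`; the `loc` supplier -/
section Half
variable {d N b : ℕ} [NeZero N] [NeZero b]

/-- **A SITE OF A POSITIVE-HALF CELL LIES IN THE TRANSPORTED POSITIVE SLAB**: if `cellOf b x = c` with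
`c ∈ halfPlus N i k` then the coordinate W3c's letters read as «time», `x_i − (cutShift b i k)_i = x_i − kb + 1`, has value
in `[1, N·b∕2]` — explicitly `(c_i − k).val·b + (x_i.val % b) + 1`.  No parity of `N` needed. [folklore] -/
theorem pos_of_cellOf_mem_halfPlus {i : Fin d} {k : ZMod N} {c : BlockIdx d N} (hc : c ∈ halfPlus N i k)
    {x : Site d (N * b)} (hx : cellOf b x = c) :
    1 ≤ (x i - cutShift b i k i).val ∧ (x i - cutShift b i k i).val ≤ N * b / 2 := by
  have hm : (c i - k).val < N / 2 := by simpa [halfPlus] using hc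
  obtain ⟨q, s, hsb, hxqs, hcq⟩ : ∃ q s : ℕ, s < b ∧ (x i).val = q * b + s ∧ c i = (q : ZMod N) :=
    ⟨(x i).val / b, (x i).val % b, Nat.mod_lt _ (Nat.pos_of_ne_zero (NeZero.ne b)), (Nat.div_add_mod' _ _).symm,
      by rw [← hx]; rfl⟩
  set m := (c i - k).val with hmdef
  have hb1 : 1 ≤ b := Nat.one_le_iff_ne_zero.2 (NeZero.ne b)
  have hN2 : N / 2 < N := Nat.div_lt_self (by omega) one_lt_two
  have h1 : m * b + s + 1 ≤ (N / 2) * b :=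
    calc m * b + s + 1 ≤ (m + 1) * b := by nlinarith
      _ ≤ (N / 2) * b := Nat.mul_le_mul_right _ (by omega)
  have h2 : (N / 2) * b < N * b := by nlinarith
  have h3 : (N / 2) * b ≤ N * b / 2 := by
    rw [Nat.le_div_iff_mul_le two_pos]
    nlinarith [Nat.div_mul_le_self N 2]
  have hmod : ((q : ℤ) - k.val) ≡ m [ZMOD N] := by
    have h1 : ((m : ℕ) : ZMod N) = (q : ZMod N) - (k.val : ZMod N) := by
      rw [hmdef, ZMod.natCast_zmod_val, ZMod.natCast_zmod_val, hcq]
    have h2 : (((q : ℤ) - k.val : ℤ) : ZMod N) = ((m : ℤ) : ZMod N) := by push_cast; rw [h1]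
    exact (ZMod.intCast_eq_intCast_iff _ _ _).1 h2
  have hcast : x i - cutShift b i k i = ((((q : ℤ) - k.val) * b + (s + 1 : ℕ) : ℤ) : ZMod (N * b)) := by
    rw [cutShift_apply_same, ← ZMod.natCast_zmod_val (x i), hxqs]
    push_cast
    ring
  have hval : (x i - cutShift b i k i).val = m * b + s + 1 := by
    rw [hcast]
    refine val_intCast_of_modEq (by omega) ?_
    obtain ⟨t, ht⟩ := Int.modEq_iff_dvd.1 hmod
    refine Int.modEq_iff_dvd.2 ⟨t, ?_⟩
    push_cast
    linear_combination (b : ℤ) * ht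
  rw [hval]
  exact ⟨by omega, by omega⟩

variable [NeZero d]

/-- **THE PULLED-BACK LINK OF A LINK INSIDE A POSITIVE-HALF CELL IS AN OSTERWALDER–SEILER POSITIVE LINK**: for
`e₀ = (x, j)` with both endpoints in a cell `c ∈ halfPlus N i k`, the link `(sitePerm (swap 0 i) (x − v), swap 0 i j)`,
`v = cutShift b i k` — the one W3c's `Φ = π_*⁻¹ ∘ τ_{−v}` reads as `U e₀` — satisfies `WilsonRP.IsPosEdge`. [folklore] -/
theorem isPosEdge_of_mem_cellLinks {i : Fin d} {k : ZMod N} {c : BlockIdx d N} (hc : c ∈ halfPlus N i k)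
    {e₀ : Edge d (N * b)} (he : e₀ ∈ cellLinks b c) :
    WilsonRP.IsPosEdge (d := d) (L := N * b)
      (sitePerm (Equiv.swap 0 i) (e₀.1 - cutShift b i k), Equiv.swap 0 i e₀.2) := by
  obtain ⟨h1, h2⟩ := mem_cellLinks.1 he
  have hA := pos_of_cellOf_mem_halfPlus (b := b) hc h1
  have hB := pos_of_cellOf_mem_halfPlus (b := b) hc h2
  have e1 : sitePerm (Equiv.swap (0 : Fin d) i) (e₀.1 - cutShift b i k) 0 = e₀.1 i - cutShift b i k i := by
    rw [sitePerm_apply, Equiv.symm_swap, Equiv.swap_apply_left, Pi.sub_apply]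
  have e2 : ((sitePerm (Equiv.swap (0 : Fin d) i) (e₀.1 - cutShift b i k)).shift (Equiv.swap 0 i e₀.2)) 0 =
      (e₀.1.shift e₀.2) i - cutShift b i k i := by
    rw [← sitePerm_shift, sitePerm_apply, Equiv.symm_swap, Equiv.swap_apply_left, Site.shift, Site.shift]
    simp only [Pi.add_apply, Pi.sub_apply]
    ring
  unfold WilsonRP.IsPosEdge
  dsimp only
  rw [e1, e2]
  exact ⟨hA.1, hA.2, hB.1, hB.2⟩

omit [NeZero N] [NeZero b] in
/-- W3c's conjugating map `Φ = π_*⁻¹ ∘ τ_{−v}` READS the pulled-back link as the original one: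
`(Φ U) (sitePerm π (x − v), π j) = U (x, j)` at `π = swap 0 i`. [folklore] -/
theorem phi_apply_pullback {G : Type*} [MeasurableSpace G] (i : Fin d) (v : Site d (N * b)) (U : GaugeConfig d (N * b) G)
    (e₀ : Edge d (N * b)) :
    configPerm (Equiv.swap 0 i).symm (torusConfigShift (-v) U)
        (sitePerm (Equiv.swap 0 i) (e₀.1 - v), Equiv.swap 0 i e₀.2) = U e₀ := by
  rw [configPerm_apply, torusConfigShift_apply]
  simp only [Equiv.symm_swap, Equiv.swap_apply_self, sub_neg_eq_add]
  congr 1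
  refine Prod.ext ?_ rfl
  funext m
  simp only [Pi.add_apply, sitePerm_apply, Equiv.symm_swap, Equiv.swap_apply_self, Pi.sub_apply, sub_add_cancel]

/-- **THE `loc` SUPPLIER AT LEVEL 0**: for a cell `c ∈ halfPlus N i k`, the σ-algebra of the links inside `c` sits below
W3c's positive σ-algebra at `(π, v) = (swap 0 i, cutShift b i k)` — so every event measurable in the links inside a
positive-half cell is positive-half measurable for the base RP-package of `rpPackage_wilson_theta`. [folklore] -/
theorem piFinset_cellLinks_le {G : Type*} [MeasurableSpace G] {i : Fin d} {k : ZMod N} {c : BlockIdx d N}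
    (hc : c ∈ halfPlus N i k) :
    (Filtration.piFinset (X := fun _ : Edge d (N * b) => G) (cellLinks b c) : MeasurableSpace (GaugeConfig d (N * b) G)) ≤
      (Filtration.piFinset (X := fun _ : Edge d (N * b) => G) WilsonRP.posEdges :
          MeasurableSpace (GaugeConfig d (N * b) G)).comap
        (fun U : GaugeConfig d (N * b) G => configPerm (Equiv.swap 0 i).symm (torusConfigShift (-(cutShift b i k)) U)) := by
  set mP₀ := (Filtration.piFinset (X := fun _ : Edge d (N * b) => G) WilsonRP.posEdges :
      MeasurableSpace (GaugeConfig d (N * b) G)) with hmP₀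
  set Φ := fun U : GaugeConfig d (N * b) G =>
      configPerm (Equiv.swap 0 i).symm (torusConfigShift (-(cutShift b i k)) U) with hΦ
  have hΦm : @Measurable _ _ (mP₀.comap Φ) mP₀ Φ := measurable_iff_comap_le.2 le_rfl
  have hcoord : ∀ e' ∈ (WilsonRP.posEdges : Finset (Edge d (N * b))),
      @Measurable _ _ mP₀ _ (fun W : GaugeConfig d (N * b) G => W e') := by
    intro e' he'
    have hres : @Measurable _ _ mP₀ _
        ((WilsonRP.posEdges : Finset (Edge d (N * b))) : Set (Edge d (N * b))).restrict :=
      measurable_iff_comap_le.2 (by rw [hmP₀, Filtration.piFinset_eq_comap_restrict])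
    exact (measurable_pi_apply (⟨e', Finset.mem_coe.2 he'⟩ :
      ↥((WilsonRP.posEdges : Finset (Edge d (N * b))) : Set (Edge d (N * b))))).comp hres
  rw [Filtration.piFinset_eq_comap_restrict]
  refine measurable_iff_comap_le.1 ((@measurable_pi_iff _ _ _ (mP₀.comap Φ) _ _).2 fun e => ?_)
  obtain ⟨e₀, he₀⟩ := e
  have he₀' : e₀ ∈ cellLinks b c := Finset.mem_coe.1 he₀
  have hpos : (sitePerm (Equiv.swap 0 i) (e₀.1 - cutShift b i k), Equiv.swap 0 i e₀.2) ∈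
      (WilsonRP.posEdges : Finset (Edge d (N * b))) :=
    WilsonRP.mem_posEdges.2 (isPosEdge_of_mem_cellLinks hc he₀')
  have hread : (fun U : GaugeConfig d (N * b) G => U e₀) =
      (fun W : GaugeConfig d (N * b) G => W (sitePerm (Equiv.swap 0 i) (e₀.1 - cutShift b i k), Equiv.swap 0 i e₀.2))
        ∘ Φ := by
    funext U
    exact (phi_apply_pullback i (cutShift b i k) U e₀).symm
  show @Measurable _ _ (mP₀.comap Φ) _ (fun U : GaugeConfig d (N * b) G => U e₀)
  rw [hread]
  exact (hcoord _ hpos).comp hΦm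
end Half

/-! ## §4 The block reflection carries cell `c` onto cell `cellReflect i k c`; the `sym` geometry -/
section Reflect
variable {d N b : ℕ} [NeZero N] [NeZero b]

omit [NeZero b] in
/-- The block cut's reflection parameter: `2·(cutShift b i k)_i + 1 = 2kb − 1`. [folklore] -/
theorem two_mul_cutShift_add_one (i : Fin d) (k : ZMod N) :
    2 * cutShift b i k i + 1 = 2 * (((k.val * b : ℕ) : ZMod (N * b))) - 1 := by
  rw [cutShift_apply_same]; ring

omit [NeZero N] [NeZero b] in
/-- `cellReflect` on the reflected axis (the tree's `cellReflect_apply`, evaluated). [folklore] -/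
theorem cellReflect_apply_same (i : Fin d) (k : ZMod N) (c : BlockIdx d N) : cellReflect i k c i = 2 * k - 1 - c i := by
  simp

/-- **THE BLOCK REFLECTION CARRIES THE FINE SITES OF CELL `c` ONTO THOSE OF `cellReflect i k c`**: the site map
`x_i ↦ 2kb − 1 − x_i` of the wall reflection at the block cut `(i, k)` composed with `cellOf` is W5's `cellReflect i k`
(`c_i ↦ 2k − 1 − c_i`): `x_i = c_i·b + s ↦ (2k − 1 − c_i)·b + (b − 1 − s)`. [folklore] -/
theorem cellOf_siteReflect (i : Fin d) (k : ZMod N) (x : Site d (N * b)) :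
    cellOf b (siteReflect i (2 * (((k.val * b : ℕ) : ZMod (N * b))) - 1) x) = cellReflect i k (cellOf b x) := by
  funext j
  by_cases hj : j = i
  · subst hj
    obtain ⟨q, s, hsb, hxqs⟩ : ∃ q s : ℕ, s < b ∧ (x j).val = q * b + s :=
      ⟨(x j).val / b, (x j).val % b, Nat.mod_lt _ (Nat.pos_of_ne_zero (NeZero.ne b)), (Nat.div_add_mod' _ _).symm⟩
    have hb : 0 < b := Nat.pos_of_ne_zero (NeZero.ne b)
    have hcx : cellOf b x j = (q : ZMod N) := by
      show (((x j).val / b : ℕ) : ZMod N) = q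
      rw [hxqs, mul_comm, Nat.mul_add_div hb, Nat.div_eq_of_lt hsb, add_zero]
    rw [cellReflect_apply_same, hcx]
    show (((( siteReflect j (2 * (((k.val * b : ℕ) : ZMod (N * b))) - 1) x) j).val / b : ℕ) : ZMod N) = 2 * k - 1 - q
    rw [siteReflect_apply_same]
    have hcast : (2 * (((k.val * b : ℕ) : ZMod (N * b))) - 1) - x j =
        ((((2 * (k.val : ℤ) - 1 - q) * b + (b - 1 - s : ℕ) : ℤ)) : ZMod (N * b)) := by
      rw [← ZMod.natCast_zmod_val (x j), hxqs, Nat.sub_sub, Nat.cast_sub (by omega : 1 + s ≤ b)]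
      push_cast
      ring
    rw [hcast, val_intCast_mul_add _ (by omega : b - 1 - s < b), mul_comm, Nat.mul_add_div hb,
      Nat.div_eq_of_lt (by omega : b - 1 - s < b), add_zero]
    have hQ : ((((2 * (k.val : ℤ) - 1 - q) % N).toNat : ℤ)) = (2 * (k.val : ℤ) - 1 - q) % N :=
      Int.toNat_of_nonneg (Int.emod_nonneg _ (by exact_mod_cast NeZero.ne N))
    rw [← Int.cast_natCast (R := ZMod N), hQ, ZMod.intCast_mod]
    push_cast
    rw [ZMod.natCast_zmod_val]
  · rw [cellReflect_apply_of_ne _ _ _ hj]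
    show (((siteReflect i _ x j).val / b : ℕ) : ZMod N) = _
    rw [siteReflect_apply_of_ne _ _ _ hj]
    rfl

variable {G : Type*} [Group G]

/-- **THE `sym` GEOMETRY**: an observable of the links inside cell `c`, composed with the wall reflection at the block cut
`(i, k)`, is an observable of the links inside `cellReflect i k c` (each link inside `c` is read — reversed and inverted
along the axis — on a link inside the reflected cell). [folklore] -/
theorem dependsOn_comp_configReflect {α : Type*} {F : GaugeConfig d (N * b) G → α} {c : BlockIdx d N} (i : Fin d)
    (k : ZMod N) (hF : DependsOn F ((cellLinks b c : Finset (Edge d (N * b))) : Set (Edge d (N * b)))) :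
    DependsOn (fun U => F (configReflect i (2 * (((k.val * b : ℕ) : ZMod (N * b))) - 1) U))
      ((cellLinks b (cellReflect i k c) : Finset (Edge d (N * b))) : Set (Edge d (N * b))) := by
  intro U V hUV
  refine hF fun e he => ?_
  obtain ⟨x, j⟩ := e
  obtain ⟨h1, h2⟩ := mem_cellLinks.1 (Finset.mem_coe.1 he)
  set A := (2 * (((k.val * b : ℕ) : ZMod (N * b))) - 1) with hA
  have hc1 : cellOf b (siteReflect i A x) = cellReflect i k c := by rw [hA, cellOf_siteReflect, h1]
  have hc2 : cellOf b (siteReflect i A (x.shift j)) = cellReflect i k c := by rw [hA, cellOf_siteReflect, h2]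
  by_cases hj : j = i
  · subst hj
    have hmem : (siteReflect j A (x.shift j), j) ∈ ((cellLinks b (cellReflect j k c) : Finset _) : Set (Edge d (N * b))) := by
      rw [Finset.mem_coe, mem_cellLinks]
      refine ⟨hc2, ?_⟩
      rw [Site.shift, siteReflect_shift_same, sub_add_cancel]
      exact hc1
    simp only [configReflect, if_true]
    rw [hUV _ hmem]
  · have hmem : (siteReflect i A x, j) ∈ ((cellLinks b (cellReflect i k c) : Finset _) : Set (Edge d (N * b))) := by
      rw [Finset.mem_coe, mem_cellLinks]
      refine ⟨hc1, ?_⟩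
      rw [← siteReflect_shift_of_ne _ _ _ hj]
      exact hc2
    simp only [configReflect, hj, if_false]
    rw [hUV _ hmem]

variable [NeZero d] [MeasurableSpace G]

/-- **THE `sym` GEOMETRY IN W3c's LETTERS**: the same for `Θ_{swap 0 i, cutShift b i k}` (by §2). [folklore] -/
theorem dependsOn_comp_theta {α : Type*} {F : GaugeConfig d (N * b) G → α} {c : BlockIdx d N} (i : Fin d) (k : ZMod N)
    (hF : DependsOn F ((cellLinks b c : Finset (Edge d (N * b))) : Set (Edge d (N * b)))) :
    DependsOn (fun U => F (torusConfigShift (cutShift b i k) (configPerm (Equiv.swap 0 i)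
        (GaugeConfig.timeReflect (configPerm (Equiv.swap 0 i).symm (torusConfigShift (-(cutShift b i k)) U))))))
      ((cellLinks b (cellReflect i k c) : Finset (Edge d (N * b))) : Set (Edge d (N * b))) := by
  have h := dependsOn_comp_configReflect (F := F) i k hF
  simp_rw [theta_swap_eq_configReflect, two_mul_cutShift_add_one]
  exact h
end Reflect

/-! ## §5 Sanity: decided instances (`d = 1`, `N = 2` cells of `b = 3` sites, block cut `(0, 1)`) -/
namespace Sanity

/-- site `4` of the `6`-torus lies in cell `1` (the positive-half cell of the cut `(0, 1)`: its transported «time» is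
`4 − (1·3 − 1) = 2 ∈ [1, 3]`); the block reflection `x ↦ 2·1·3 − 1 − x` sends it to `1`, in cell `0 = cellReflect 0 1 1`. -/
example : cellOf (N := 2) 3 (fun _ : Fin 1 => (4 : ZMod (2 * 3))) = (fun _ => (1 : ZMod 2)) ∧
    ((4 : ZMod (2 * 3)) - cutShift (N := 2) 3 (0 : Fin 1) (1 : ZMod 2) 0).val = 2 ∧
    cellOf (N := 2) 3 (siteReflect (0 : Fin 1) (2 * (((1 * 3 : ℕ) : ZMod (2 * 3))) - 1)
      (fun _ : Fin 1 => (4 : ZMod (2 * 3)))) = cellReflect (0 : Fin 1) (1 : ZMod 2) (fun _ => (1 : ZMod 2)) := by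
  decide

end Sanity


end

end Summit.QuantumFields.BalabanUV.T4Continuum.HistoryRPBlocks
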